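import Literature.MathematicalPhysics.QuantumFieldTheory.Balaban1983to89.B13ConditioningBlockWalks

/-!
# `Balaban1983to89.B13ConditionedTermKernels` — T. Bałaban, *Renormalization group approach to lattice gauge field
theories. II. Cluster expansions*, Commun. Math. Phys. **116** (1988) 1–22 [Balaban1988RG2Cluster], (2.5)–(2.7)
pp. 12–13 and (2.14) p. 15: THE CONDITIONING STEP AS A CONSTRUCTION — the kernel record `TermKernels` of ONE (2.14)-term
BUILT from ONE operator family `K(σ,u)` (print: `C*Δ_k(σ,𝐔,𝐉)C` on the term's bond set, interior `Z₀`-bonds ⊕ exterior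
`Z₀ᶜ`-bonds) whose reference value `K(0,0)` is a real positive definite matrix `K₀`: term precision `A2 := K.toBlocks₁₁`,
Γ-kernel `G2 := fromCols 0 K.toBlocks₁₂ · invSqrt K`, covariance `C := (K₀.toBlocks₁₁)⁻¹ ≻ 0`, real Γ-kernel
`Γ₀ := fromCols 0 K₀.toBlocks₁₂ · K₀^{−1/2}`, rows located where the interior columns are — so that the block reading of
`B13ConditioningBlockWalks` holds BY `rfl` and NODE A's per-term reference rung for the constructed record follows from
ONE joint walk expansion and ONE positivity of `K`

statement-level bookkeeping over published theorems with citation tags; kernel-checked compositions of tree theorems;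
nothing here is a claim about the Yang–Mills mass gap.

CITATION HEADER: as `B13ConditioningBlockWalks` ((2.5)–(2.6) pp. 12–13, verbatim there; p. 13 ll. 14–23 *"This
construction was discussed in [13] for all operators determining Δ_k, and for C^{(k)}(Z₀), but not for (C^{(k)})^{1/2}"*;
(2.7) p. 13; (2.14) p. 15 *"Γ_k(Z₀, σ(Z)) = C\*Δ_k(σ(Z))CZ₀ᶜ(C^{(k)})^{1/2}(σ(Z))"*, *"For the pair (U′, 0) the operators are
symmetric, and the measure is positive"*).  [13] = [Balaban1985BackgroundPropagators] Thm 3.10 p. 416, Thm 3.12 p. 423.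

WHY (cell `pub-ymgap`, D-0062 Track A, node N10 = [B13]; seat `pub-ymgap-dag-n10-c` g3, module 19).  Module 17
(`B13ConditioningBlockWalks`, p479511) proves that kernel data `𝒦 : TermKernels` READ IN BLOCK FORM off one operator
(`hA2`, `hG2`, `hloc` as HYPOTHESES) carry the reference rung from one expansion + one positivity of that operator.  A
term tower OF RECORD (the definers' object, def-T ∕ def-B13) will BUILD `𝒦` from Bałaban's `C*Δ_k(σ)C`; this file is
the constructor that makes the three reading hypotheses definitional, discharges the record's three reference-data
obligations (`hG0`: the Γ-kernel is real at `(0,0)` — `invSqrt_map_ofReal`; `hC0`: the covariance is the inverse of the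
real interior block — a field hom commutes with the nonsingular inverse; `hC`: it is positive definite — principal
block and inverse of a positive definite matrix, `Matrix.PosDef.submatrix` ∕ `.inv`), and re-exports the rung and the
structural letters for the constructed record with NO reading hypothesis left.

WHAT THIS FILE PROVIDES.
§1 `condKernels c K K₀ hK₀ hpd locN X m hfib : TermKernels c d N' ν Nf E` (an `abbrev` with body — a MODEL-LEVEL
   constructor, no `Prop` placeholder): the record above; `condKernels_A2`, `condKernels_G2`, `condKernels_locΛ`,
   `condKernels_C` (the block reading and the covariance, by `rfl`).
§2 `termWalksRef_condKernels` — `X ≠ ∅`, ONE joint walk expansion of `K` through `X` (`K̄ ≥ 0`), `m`-positivity of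
   `Re K(0,0)`, far-ness ∕ multiplicity of `locN`, dimension, any dominated reference package `r` ⟹
   `TermWalksRef (condKernels …) r` (module 17's `termWalksRef_of_conditionedBlocks` with the three readings `rfl`);
   `termWalksRef_condKernels_at` (at one package's full-precision letters).
§3 `isSymm_condKernels_A2`, `differentiableOn_condKernels_A2`, `differentiableOn_condKernels_G2` — the record
   junctions' letters `hAs`, `hAhol`, `hGhol` for the constructed record from symmetry ∕ σ-holomorphy of `K` (+ the one
   expansion and positivity under print's two perturbative thresholds for `hGhol`), by module 17.
§4 `refAcc_of_real` — the `m`-positivity of `Re K(0,0)` at a real `K₀` from the REAL Rayleigh bound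
   `hm : ∀ x, m·‖x‖² ≤ xᵀK₀x` (complex test vectors split into real and imaginary parts; no cross terms).
HONEST FRAMING: a kernel-level CONSTRUCTION on the tree's hypothesis shapes (finite matrices; `invSqrt` is the tree's
resolvent integral (2.7)); the tree's (2.14) reading takes inverse and square root AFTER s-decoration (print decorates
the three operator arguments of `G` in (2.8) separately) — declared in module 17's header; NOTHING of Bałaban's
`C*Δ_k(σ,𝐔,𝐉)C` is constructed here — `K` is a PARAMETER; whether HIS operator carries one joint walk expansion with
k-uniform constants at complex backgrounds is NODE A ([13] Thms 3.10∕3.12, (1.11); node N06 s4 ∕ row (D4)), the INPUT of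
§2–§3; count-neutral; NOT a discharge of N10; no `sorry`, no instance, no notation; standard axioms; NOT [B12] Thm 2,
nothing continuum ∕ ℝ⁴ ∕ OS ∕ mass gap ∕ Clay.
-/

noncomputable section

namespace Literature.MathematicalPhysics.QuantumFieldTheory.Balaban1983to89.B13ConditionedTermKernels

open Metric Set Finset
open scoped Matrix
open Literature.MathematicalPhysics.QuantumFieldTheory.Balaban1983to89
open Literature.MathematicalPhysics.QuantumFieldTheory.Balaban1983to89.B9Thm37GlueTorus (tdist1)
open Literature.MathematicalPhysics.QuantumFieldTheory.Balaban1983to89.TreeLengthTorus (TPt)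
open Literature.MathematicalPhysics.QuantumFieldTheory.Balaban1983to89.B5TorusCover (UT)
open Literature.MathematicalPhysics.QuantumFieldTheory.Balaban1983to89.B13JointWalkExpansion (JointWalkExpansion)
open Literature.MathematicalPhysics.QuantumFieldTheory.Balaban1983to89.B13TermWalkData (TermKernels)
open Literature.MathematicalPhysics.QuantumFieldTheory.Balaban1983to89.B13Sqrt27Accretive (invSqrt invSqrt_map_ofReal)
open Literature.MathematicalPhysics.QuantumFieldTheory.Balaban1983to89.NodeOLettersOfWalksPerturbative
  (RefPackage TermWalksRef)
open Literature.MathematicalPhysics.QuantumFieldTheory.Balaban1983to89.B13ConditioningBlockWalks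
  (termWalksRef_of_conditionedBlocks termWalksRef_of_conditionedBlocks_at isSymm_toBlocks₁₁
    differentiableOn_toBlocks₁₁_apply differentiableOn_offBlock_mul_invSqrt_apply setOf_forall_mem_ball_eq_ball
    accretive_of_conditionedBlocks_at)

variable {d N' : ℕ} {ν : ℕ} {Nf : Fin ν → ℕ} [∀ i, NeZero (Nf i)]
variable {E : Type*} [NormedAddCommGroup E] [NormedSpace ℂ E]
variable {Λ C₀ : Type} [Fintype Λ] [DecidableEq Λ] [Fintype C₀] [DecidableEq C₀]

/-! ## §1. The constructor -/

/-- Inversion commutes with the real-to-complex entry map. [folklore] -/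
private theorem map_inv_ofReal {n : Type} [Fintype n] [DecidableEq n] (A : Matrix n n ℝ) :
    (A.map (algebraMap ℝ ℂ))⁻¹ = A⁻¹.map (algebraMap ℝ ℂ) := by
  rw [Matrix.inv_def, Matrix.inv_def, Ring.inverse_eq_inv, Ring.inverse_eq_inv]
  have hdet : (A.map (algebraMap ℝ ℂ)).det = algebraMap ℝ ℂ A.det := by
    rw [RingHom.map_det]; rfl
  have hadj : (A.map (algebraMap ℝ ℂ)).adjugate = A.adjugate.map (algebraMap ℝ ℂ) := by
    have h := RingHom.map_adjugate (algebraMap ℝ ℂ) A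
    rw [RingHom.mapMatrix_apply, RingHom.mapMatrix_apply] at h
    exact h.symm
  rw [hdet, hadj, ← map_inv₀]
  ext i j
  simp [Matrix.map_apply, Matrix.smul_apply]

omit [Fintype Λ] [DecidableEq Λ] [Fintype C₀] [DecidableEq C₀] in
/-- The interior block of the complexification is the complexification of the interior block. [folklore] -/
private theorem toBlocks₁₁_map (K₀ : Matrix (Λ ⊕ C₀) (Λ ⊕ C₀) ℝ) :
    (K₀.map (algebraMap ℝ ℂ)).toBlocks₁₁ = K₀.toBlocks₁₁.map (algebraMap ℝ ℂ) := rfl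

omit [Fintype Λ] [DecidableEq Λ] [Fintype C₀] [DecidableEq C₀] in
/-- The padded off-diagonal block of the complexification is the complexification of the padded block. [folklore] -/
private theorem offBlock_map (K₀ : Matrix (Λ ⊕ C₀) (Λ ⊕ C₀) ℝ) :
    Matrix.fromCols (0 : Matrix Λ Λ ℂ) (K₀.map (algebraMap ℝ ℂ)).toBlocks₁₂
      = (Matrix.fromCols (0 : Matrix Λ Λ ℝ) K₀.toBlocks₁₂).map (algebraMap ℝ ℂ) := by
  rw [Matrix.fromCols_map, Matrix.map_zero _ (map_zero _)]
  rfl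

/-- **THE KERNEL RECORD OF A (2.14)-TERM BUILT FROM ONE CONDITIONED OPERATOR** ((2.5)–(2.6) as a construction; an
`abbrev`, so that the record's index types and fields reduce): given the operator family `K(σ,u)` on the bond set
`Λ ⊕ C₀` (print: `C\*Δ_k(σ,𝐔,𝐉)C`; interior `inl`, exterior `inr`) with REAL POSITIVE DEFINITE reference value `K(0,0) =
K₀` (print p. 15: at `(U′,0)` the operators are symmetric and the measure is positive), the location map `locN` of the
bonds, the σ-region `X` and a fibre bound `m` of the interior locations, the term's kernel data are: precision `A2 :=
K.toBlocks₁₁` (`Δ^{(k)}(Z₀,σ)`), Γ-kernel `G2 := fromCols 0 K.toBlocks₁₂ · invSqrt K` (`Z₀(C\*Δ_kC)Z₀ᶜ · (C^{(k)})^{1/2}`,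
`B13Term214.Gamma214`), `Γ₀ := fromCols 0 K₀.toBlocks₁₂ · K₀^{−1/2}` (functional calculus), `C := (K₀.toBlocks₁₁)⁻¹`,
`locΛ := locN ∘ inl`.  The record's obligations `hG0`, `hC0` (reference values real) and `hC` (`C ≻ 0`) are PROVED.
[cite: Balaban1988RG2Cluster, (2.5)–(2.7) pp.12–13, (2.14) p.15] -/
abbrev condKernels (c : B13.Consts) (K : (TPt d N' → ℂ) → E → Matrix (Λ ⊕ C₀) (Λ ⊕ C₀) ℂ)
    (K₀ : Matrix (Λ ⊕ C₀) (Λ ⊕ C₀) ℝ) (hK₀ : K 0 0 = K₀.map (algebraMap ℝ ℂ)) (hpd : K₀.PosDef)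
    (locN : Λ ⊕ C₀ → UT Nf) (X : Finset (UT Nf)) (m : ℕ)
    (hfib : ∀ x : UT Nf, (Finset.univ.filter fun i : Λ => locN (Sum.inl i) = x).card ≤ m) :
    TermKernels c d N' ν Nf E where
  Λ := Λ
  C₀ := C₀
  A2 := fun σ u => (K σ u).toBlocks₁₁
  G2 := fun σ u => Matrix.fromCols (0 : Matrix Λ Λ ℂ) (K σ u).toBlocks₁₂ * invSqrt (K σ u)
  Γ₀ := Matrix.fromCols (0 : Matrix Λ Λ ℝ) K₀.toBlocks₁₂ * cfc (fun t : ℝ => (Real.sqrt t)⁻¹) K₀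
  C := (K₀.toBlocks₁₁)⁻¹
  locΛ := locN ∘ Sum.inl
  locN := locN
  X := X
  m := m
  hfib := hfib
  hG0 := by
    show Matrix.fromCols (0 : Matrix Λ Λ ℂ) (K 0 0).toBlocks₁₂ * invSqrt (K 0 0)
      = (Matrix.fromCols (0 : Matrix Λ Λ ℝ) K₀.toBlocks₁₂ * cfc (fun t : ℝ => (Real.sqrt t)⁻¹) K₀).map (algebraMap ℝ ℂ)
    rw [hK₀, offBlock_map, invSqrt_map_ofReal hpd, Matrix.map_mul]
  hC0 := by
    show ((K 0 0).toBlocks₁₁)⁻¹ = (K₀.toBlocks₁₁)⁻¹.map (algebraMap ℝ ℂ)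
    rw [hK₀, toBlocks₁₁_map, map_inv_ofReal]
  hC := (hpd.submatrix Sum.inl_injective).inv

section Readings

variable {c : B13.Consts} {K : (TPt d N' → ℂ) → E → Matrix (Λ ⊕ C₀) (Λ ⊕ C₀) ℂ}
  {K₀ : Matrix (Λ ⊕ C₀) (Λ ⊕ C₀) ℝ} {hK₀ : K 0 0 = K₀.map (algebraMap ℝ ℂ)} {hpd : K₀.PosDef}
  {locN : Λ ⊕ C₀ → UT Nf} {X : Finset (UT Nf)} {m : ℕ}
  {hfib : ∀ x : UT Nf, (Finset.univ.filter fun i : Λ => locN (Sum.inl i) = x).card ≤ m}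

/-- The block reading of the precision holds by `rfl`. [cite: Balaban1988RG2Cluster, (2.5) p.12] -/
theorem condKernels_A2 (σ : TPt d N' → ℂ) (u : E) :
    (condKernels c K K₀ hK₀ hpd locN X m hfib).A2 σ u = (K σ u).toBlocks₁₁ := rfl

/-- The block reading of the Γ-kernel holds by `rfl`. [cite: Balaban1988RG2Cluster, (2.6) p.13, (2.14) p.15] -/
theorem condKernels_G2 (σ : TPt d N' → ℂ) (u : E) :
    (condKernels c K K₀ hK₀ hpd locN X m hfib).G2 σ u
      = Matrix.fromCols (0 : Matrix Λ Λ ℂ) (K σ u).toBlocks₁₂ * invSqrt (K σ u) := rfl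

/-- The interior rows sit where the interior columns sit, by `rfl`. [cite: Balaban1988RG2Cluster, (2.5) p.12] -/
theorem condKernels_locΛ (i : Λ) :
    (condKernels c K K₀ hK₀ hpd locN X m hfib).locΛ i = (condKernels c K K₀ hK₀ hpd locN X m hfib).locN (Sum.inl i) :=
  rfl

/-- The covariance of the constructed record is the inverse of the real interior block, by `rfl` (print:
`C^{(k)}(Z₀) = (Z₀(C\*Δ_kC)Z₀)⁻¹`). [cite: Balaban1988RG2Cluster, (2.5)–(2.6) pp.12–13] -/
theorem condKernels_C : (condKernels c K K₀ hK₀ hpd locN X m hfib).C = (K₀.toBlocks₁₁)⁻¹ := rfl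

end Readings

/-! ## §2. NODE A's reference rung for the constructed record from ONE expansion and ONE positivity -/

section Rung

variable {c : B13.Consts} {K : (TPt d N' → ℂ) → E → Matrix (Λ ⊕ C₀) (Λ ⊕ C₀) ℂ}
  {K₀ : Matrix (Λ ⊕ C₀) (Λ ⊕ C₀) ℝ} {hK₀ : K 0 0 = K₀.map (algebraMap ℝ ℂ)} {hpd : K₀.PosDef}
  {locN : Λ ⊕ C₀ → UT Nf} {X : Finset (UT Nf)} {m : ℕ}
  {hfib : ∀ x : UT Nf, (Finset.univ.filter fun i : Λ => locN (Sum.inl i) = x).card ≤ m}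

/-- **THE REFERENCE RUNG OF THE CONSTRUCTED RECORD**: `X ≠ ∅`, ONE joint walk expansion of `K` through `X` on the
`R`-ball (drop `ε`, torus rate `κ`, constant `K̄ ≥ 0`), `m′`-positivity of `Re K(0,0)`, far-ness `R_σ` and multiplicity
`n_B` of `locN`, dimension `≤ d_m`, and any reference package `r` dominated by these letters give
`TermWalksRef (condKernels …) r` — `B13ConditioningBlockWalks.termWalksRef_of_conditionedBlocks` with the three block
readings discharged by `rfl`.  NOT supplied: this datum for BAŁABAN's operator.
[cite: Balaban1988RG2Cluster, (2.5)–(2.7) pp.12–13, (2.14) p.15, (2.16) p.16; Balaban1985BackgroundPropagators, Thm 3.10 p.416, Thm 3.12 p.423] -/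
theorem termWalksRef_condKernels (hX : X.Nonempty)
    {R ε kap Kbar : ℝ} {W : Type} {T : W → (TPt d N' → ℂ) → E → Matrix (Λ ⊕ C₀) (Λ ⊕ C₀) ℂ}
    {SX : Set W} {A : W → ℝ} {D : W → UT Nf → UT Nf → ℝ} {ρ : ℝ}
    (hK : JointWalkExpansion c locN locN K X R ε kap Kbar T SX A D ρ) (hKbar : 0 ≤ Kbar)
    {m' : ℝ} (hacc : ∀ v : Λ ⊕ C₀ → ℂ, m' * ∑ i, ‖v i‖ ^ 2 ≤ (∑ i, star (v i) * (K 0 0 *ᵥ v) i).re)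
    {Rσ : ℝ} (hfar : ∀ k : Λ ⊕ C₀, ∀ z ∈ X, Rσ ≤ tdist1 Nf (locN k) z)
    {nB : ℕ} (hmult : ∀ x : UT Nf, (Finset.univ.filter fun k : Λ ⊕ C₀ => locN k = x).card ≤ nB)
    {dm : ℕ} (hdim : ν ≤ dm)
    (r : RefPackage) (hrR : r.R ≤ R)
    (hεL : r.εL ≤ ε) (hκL : r.kapL ≤ kap) (hKL : Kbar ≤ r.KbarL)
    (hεP : r.εP ≤ ε) (hκP : r.kapP ≤ kap) (hKP : Kbar ≤ r.KbarP)
    (hεA : r.εA ≤ ε) (hκA : r.kapA ≤ kap) (hKA : Kbar ≤ r.KbarA)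
    (hm₀ : r.m₀ ≤ m') (hmA : r.mA₀ ≤ m') (hRσ : r.Rσ ≤ Rσ) (hnB : nB ≤ r.nB) (hdm : dm ≤ r.dm) :
    TermWalksRef (condKernels c K K₀ hK₀ hpd locN X m hfib) r :=
  termWalksRef_of_conditionedBlocks (𝒦 := condKernels c K K₀ hK₀ hpd locN X m hfib) (K := K) (fun _ _ => rfl)
    (fun _ _ => rfl) (fun _ => rfl) hX hK hKbar hacc hfar hmult hdim r hrR hεL hκL hKL hεP hκP hKP hεA hκA hKA hm₀ hmA
    hRσ hnB hdm

/-- **THE SAME AT THE LETTERS OF ONE REFERENCE PACKAGE** (the expansion at `rf`'s full-precision letters, the other two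
slots dominated inside `rf`). [cite: Balaban1988RG2Cluster, (2.5)–(2.7) pp.12–13, (2.14) p.15; Balaban1985BackgroundPropagators, Thm 3.10 p.416, Thm 3.12 p.423] -/
theorem termWalksRef_condKernels_at (hX : X.Nonempty) (rf : RefPackage) (hrf : rf.Admissible)
    {W : Type} {T : W → (TPt d N' → ℂ) → E → Matrix (Λ ⊕ C₀) (Λ ⊕ C₀) ℂ}
    {SX : Set W} {A : W → ℝ} {D : W → UT Nf → UT Nf → ℝ} {ρ : ℝ}
    (hK : JointWalkExpansion c locN locN K X rf.R rf.εP rf.kapP rf.KbarP T SX A D ρ)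
    (hacc : ∀ v : Λ ⊕ C₀ → ℂ, rf.m₀ * ∑ i, ‖v i‖ ^ 2 ≤ (∑ i, star (v i) * (K 0 0 *ᵥ v) i).re)
    (hfar : ∀ k : Λ ⊕ C₀, ∀ z ∈ X, rf.Rσ ≤ tdist1 Nf (locN k) z)
    (hmult : ∀ x : UT Nf, (Finset.univ.filter fun k : Λ ⊕ C₀ => locN k = x).card ≤ rf.nB)
    (hdim : ν ≤ rf.dm)
    (hεL : rf.εL ≤ rf.εP) (hκL : rf.kapL ≤ rf.kapP) (hKL : rf.KbarP ≤ rf.KbarL)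
    (hεA : rf.εA ≤ rf.εP) (hκA : rf.kapA ≤ rf.kapP) (hKA : rf.KbarP ≤ rf.KbarA) (hmA : rf.mA₀ ≤ rf.m₀) :
    TermWalksRef (condKernels c K K₀ hK₀ hpd locN X m hfib) rf :=
  termWalksRef_of_conditionedBlocks_at (𝒦 := condKernels c K K₀ hK₀ hpd locN X m hfib) (K := K) (fun _ _ => rfl)
    (fun _ _ => rfl) (fun _ => rfl) hX rf hrf hK hacc hfar hmult hdim hεL hκL hKL hεA hκA hKA hmA

end Rung

/-! ## §3. The structural letters of the record junctions for the constructed record -/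

section Letters

variable {c : B13.Consts} {K : (TPt d N' → ℂ) → E → Matrix (Λ ⊕ C₀) (Λ ⊕ C₀) ℂ}
  {K₀ : Matrix (Λ ⊕ C₀) (Λ ⊕ C₀) ℝ} {hK₀ : K 0 0 = K₀.map (algebraMap ℝ ℂ)} {hpd : K₀.PosDef}
  {locN : Λ ⊕ C₀ → UT Nf} {X : Finset (UT Nf)} {m : ℕ}
  {hfib : ∀ x : UT Nf, (Finset.univ.filter fun i : Λ => locN (Sum.inl i) = x).card ≤ m}

/-- **`hAs` for the constructed record**: complex symmetry of `K(σ,u)` gives that of the term precision.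
[cite: Balaban1988RG2Cluster, (2.5) p.12, (2.14) p.15] -/
theorem isSymm_condKernels_A2 {σ : TPt d N' → ℂ} {u : E} (hK : (K σ u).IsSymm) :
    ((condKernels c K K₀ hK₀ hpd locN X m hfib).A2 σ u).IsSymm :=
  isSymm_toBlocks₁₁ hK

/-- **`hAhol` for the constructed record**: entrywise σ-holomorphy of `K(·,u)` on a set gives that of the precision.
[cite: Balaban1988RG2Cluster, (2.5) p.12, (2.14) p.15] -/
theorem differentiableOn_condKernels_A2 [NeZero N'] {u : E} {U : Set (TPt d N' → ℂ)}
    (hKhol : ∀ k l, DifferentiableOn ℂ (fun σ => K σ u k l) U) (i j : Λ) :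
    DifferentiableOn ℂ (fun σ => (condKernels c K K₀ hK₀ hpd locN X m hfib).A2 σ u i j) U :=
  differentiableOn_toBlocks₁₁_apply (K := fun σ => K σ u) hKhol i j

/-- **`hGhol` for the constructed record**: ONE joint walk expansion of `K` at a reference package's full-precision
letters, `m₀`-positivity of `Re K(0,0)`, far-ness, multiplicity, dimension, a radius `0 ≤ R₁ < R` with print's two
perturbative thresholds, a configuration `‖u‖ ≤ R₁` and entrywise σ-holomorphy of `K(·,u)` on the open `e^{κ₁}`-polydisc
give σ-holomorphy of every entry of the Γ-kernel `G2(·,u)` there (uniform `m₀/2`-accretivity of `K` by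
`accretive_of_conditionedBlocks_at`, then the square root (2.7) by `differentiableOn_offBlock_mul_invSqrt_apply`).
[cite: Balaban1988RG2Cluster, (2.5)–(2.7) pp.12–13, (2.14) p.15, (2.16) p.16; Balaban1985BackgroundPropagators, Thm 3.10 p.416, Thm 3.12 p.423] -/
theorem differentiableOn_condKernels_G2 [NeZero N'] (rf : RefPackage) (hrf : rf.Admissible)
    {W : Type} {T : W → (TPt d N' → ℂ) → E → Matrix (Λ ⊕ C₀) (Λ ⊕ C₀) ℂ}
    {SX : Set W} {A : W → ℝ} {D : W → UT Nf → UT Nf → ℝ} {ρ : ℝ}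
    (hK : JointWalkExpansion c locN locN K X rf.R rf.εP rf.kapP rf.KbarP T SX A D ρ)
    (hacc : ∀ v : Λ ⊕ C₀ → ℂ, rf.m₀ * ∑ i, ‖v i‖ ^ 2 ≤ (∑ i, star (v i) * (K 0 0 *ᵥ v) i).re)
    (hfar : ∀ k : Λ ⊕ C₀, ∀ z ∈ X, rf.Rσ ≤ tdist1 Nf (locN k) z)
    (hmult : ∀ x : UT Nf, (Finset.univ.filter fun k : Λ ⊕ C₀ => locN k = x).card ≤ rf.nB)
    (hdim : ν ≤ rf.dm) {R₁ : ℝ} (hR₁ : 0 ≤ R₁) (hR₁R : R₁ < rf.R)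
    (hPσ : 8 * rf.KbarP * rf.cV₀ * Real.exp (-(rf.εP * rf.Rσ)) ≤ rf.m₀) (hP₁ : 8 * rf.KbarP * rf.cV₀ * R₁ ≤ rf.m₀ * rf.R)
    {u : E} (hu : ‖u‖ ≤ R₁)
    (hKhol : ∀ k l, DifferentiableOn ℂ (fun σ => K σ u k l)
      {σ : TPt d N' → ℂ | ∀ j, σ j ∈ Metric.ball (0 : ℂ) (Real.exp c.κ₁)}) (i : Λ) (j : Λ ⊕ C₀) :
    DifferentiableOn ℂ (fun σ => (condKernels c K K₀ hK₀ hpd locN X m hfib).G2 σ u i j)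
      {σ : TPt d N' → ℂ | ∀ j, σ j ∈ Metric.ball (0 : ℂ) (Real.exp c.κ₁)} := by
  have hm : 0 < rf.m₀ / 2 := by linarith [hrf.hm₀]
  show DifferentiableOn ℂ
    (fun σ => (Matrix.fromCols (0 : Matrix Λ Λ ℂ) (K σ u).toBlocks₁₂ * invSqrt (K σ u)) i j)
    {σ : TPt d N' → ℂ | ∀ j, σ j ∈ Metric.ball (0 : ℂ) (Real.exp c.κ₁)}
  rw [setOf_forall_mem_ball_eq_ball (Real.exp_pos _)]
  refine differentiableOn_offBlock_mul_invSqrt_apply (fun σ => K σ u) hm (fun σ hσ v => ?_) (fun k l => ?_) i j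
  · have hσ' : ∀ j, ‖σ j‖ ≤ Real.exp c.κ₁ := fun j => by
      rw [← setOf_forall_mem_ball_eq_ball (Real.exp_pos _)] at hσ
      have hj := hσ j
      rw [Metric.mem_ball, dist_zero_right] at hj
      exact hj.le
    exact accretive_of_conditionedBlocks_at rf hrf hK hacc hfar hmult hdim hR₁ hR₁R hPσ hP₁ σ hσ' hu v
  · have hk := hKhol k l
    rwa [setOf_forall_mem_ball_eq_ball (Real.exp_pos _)] at hk

end Letters

/-! ## §4. The reference positivity from the real Rayleigh bound of `K₀` -/

section Positivity

/-- **POSITIVITY OF `Re K(0,0)` FROM THE REAL RAYLEIGH BOUND OF `K₀`** (print p. 15: at `(U′,0)` the operators are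
real and positive): if `m·‖x‖² ≤ xᵀK₀x` for REAL vectors, then for complex `v`, `m·Σ‖v_i‖² ≤ Re⟨v, K₀v⟩` — the
positivity hypothesis of §2–§3 at `K(0,0) = K₀` (a real matrix acts separately on real and imaginary parts; the real
part of the sesquilinear form is the sum of the two real forms). [cite: Balaban1988RG2Cluster, p.15] -/
theorem refAcc_of_real {n : Type} [Fintype n] (K₀ : Matrix n n ℝ) {m : ℝ}
    (hm : ∀ x : n → ℝ, m * ∑ i, x i ^ 2 ≤ ∑ i, x i * (K₀ *ᵥ x) i) (v : n → ℂ) :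
    m * ∑ i, ‖v i‖ ^ 2 ≤ (∑ i, star (v i) * (K₀.map (algebraMap ℝ ℂ) *ᵥ v) i).re := by
  have hre : ∀ i, ((K₀.map (algebraMap ℝ ℂ) *ᵥ v) i).re = (K₀ *ᵥ fun j => (v j).re) i := fun i => by
    simp [Matrix.mulVec, dotProduct, Matrix.map_apply, Complex.re_sum]
  have him : ∀ i, ((K₀.map (algebraMap ℝ ℂ) *ᵥ v) i).im = (K₀ *ᵥ fun j => (v j).im) i := fun i => by
    simp [Matrix.mulVec, dotProduct, Matrix.map_apply, Complex.im_sum]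
  have h1 : ∀ i, (star (v i) * (K₀.map (algebraMap ℝ ℂ) *ᵥ v) i).re
      = (v i).re * (K₀ *ᵥ fun j => (v j).re) i + (v i).im * (K₀ *ᵥ fun j => (v j).im) i := fun i => by
    rw [Complex.mul_re, hre, him, Complex.star_def, Complex.conj_re, Complex.conj_im]
    ring
  have hnorm : ∀ i, ‖v i‖ ^ 2 = (v i).re ^ 2 + (v i).im ^ 2 := fun i => by
    rw [Complex.sq_norm, Complex.normSq_apply]; ring
  rw [Complex.re_sum, Finset.sum_congr rfl fun i _ => h1 i, Finset.sum_add_distrib,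
    Finset.sum_congr rfl fun i _ => hnorm i, Finset.sum_add_distrib, mul_add]
  exact add_le_add (hm _) (hm _)

end Positivity

end Literature.MathematicalPhysics.QuantumFieldTheory.Balaban1983to89.B13ConditionedTermKernels

end
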